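import Mathlib.CategoryTheory.Endomorphism
import Literature.AnabelianGeometry.EtaleTheta.TemperedCoverings
import Literature.AnabelianGeometry.EtaleTheta.TemperedFrobenioidModel

/-!
# [EtTh] §4 "General Bi-Kummer Theory", part 1: the setting of §4, Definition 4.1, Remark 4.1.1

Source: [MochizukiEtTh2009] §4, PDF pp. 86–88 (printed 312–314). Locators `p.N` = PDF page.
The sequel file `BiKummerRoots.lean` (NOT this file) types Propositions 4.2–4.3, Remarks 4.3.1–4.3.2,
Theorem 4.4 and Remark 4.4.1 over the setting defined here.

## The setting (p.86) and how it is typed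

"we fix a tempered Frobenioid `C` whose monoid type is `ℤ`, whose divisor monoid `Φ` is perfect,
whose base category `D` is of the form `D := D₀[D] (⊆ D₀)` … and whose base-field-theoretic hull we
denote by `C^{bs-fld} ⊆ C`. Also, we fix a Frobenius-trivial object `A_⊙ ∈ Ob(C)` such that
`A_⊙^bs := Base(A_⊙) ∈ Ob(D)` is a Galois object. Thus, `A_⊙^bs` determines normal open subgroups
`H_⊙ ⊆ Π^tp_X`; `H_⊙^{bs-fld} ⊆ G_K` …. Recall that pre-steps of `C` map to isomorphisms in `C^birat`
…. In particular, … any base-equivalent pair of pre-steps `s', s'' : A → B` in `C` determines … an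
element "`s' · (s'')⁻¹`" `∈ O^×(A^birat)`."

The Frobenioid `C` is the CATEGORY `TemperedFrobenioid.category` (the model Frobenioid of
Def 3.6 (ii), `TemperedFrobenioidModel.lean`, [FrdI] Thm 5.2 (i)) with its pre-Frobenioid structure
`toElem : C → F_Φ`; through it the [FrdI] Def 1.2 notions (pre-steps, linear / pull-back / Frobenius-
type morphisms, isometries, base-identity endomorphisms, Frobenius degree, `O^×(A)`,
Frobenius-trivial objects, zero divisors) are the tree's `Frobenioids.PreFrobenioid.*`, and
`μ_N(A)`, `μ_N`-saturation ([FrdII] Def 2.1 (i)) are real (`TemperedFrobenioid.mu`,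
`IsMuSaturated`). What is NOT yet in the tree — the birationalization `C^birat` with `O^×(A^birat)`
([FrdI] Prop 4.4, seat abc-iut-L1-t3), disjointness of supports ([FrdI] Prop 4.1 (iii)),
base-Frobenius pairs ([FrdI] Def 2.7 / Prop 5.6, seat abc-iut-L1-t2), `(N,H)`-saturation and
Kummer classes in `C^{bs-fld}` ([FrdII] Def 2.2, seat abc-iut-L1-t4), Galois objects of the
temperoid and `Π^tp_X ↠ Aut_D(A^bs)` ([SemiAnbd] §3, seat abc-iut-L3-t2) — is carried by ONE
hypothesis structure `BiKummerSetting` whose fields quote print (TODO-merge markers name the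
owner seat). Over it, Definition 4.1 (i)–(iv) are REAL definitions (structures/predicates built
from the fields) and Remark 4.1.1 is a named `Prop`. ERRATUM E2, approach (B)
([IUTchI] Rmk 3.2.4 (iv)(B), kurims p.76): Def. 4.1 (i) may be modified by requiring condition
(d) "for every `N ∈ ℕ_{≥1}`, there exists a linear morphism `A' → A` in `C` such that the pull-back
of `f` to `A'` admits an `N`-th root" — typed as `FractionPair.CondD`; IUT itself uses approach
(A) (see `TemperedCoverings.lean`); the proof of Prop. 4.2 (iii) (sequel file) is where E2 matters.
-/

noncomputable section

namespace Literature.AnabelianGeometry.EtaleTheta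

open CategoryTheory Opposite Literature.AlgebraicGeometry.Frobenioids

universe u₀ v₀ u v w

variable {K : Type u₀} [Field K]

/-! ## The setting of §4 (p.86) as a hypothesis structure -/

/-- **The setting of [EtTh] §4** (p.86) over a tempered Frobenioid, with the [FrdI]/[FrdII]
Frobenioid-level vocabulary that §4 uses carried as fields (TODO-merge: abc-iut-found for [FrdI]
Defs 1.1–1.3, abc-iut-L1-t2 for [FrdI] Def 2.7/Prop 5.6, abc-iut-L1-t3 for [FrdI] Props 4.1, 4.4,
abc-iut-L1-t4 for [FrdII] Defs 2.1–2.2). `C` is the (model) Frobenioid of the tempered Frobenioid;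
`base : C ⥤ D` its projection; `X` the tempered fundamental group `Π^tp_X ↠ G_K` ([SemiAnbd] Ex 3.10
interface `TemperedArithmeticGroup`).
[cite: MochizukiEtTh2009, Def 4.1 p.86] -/
structure BiKummerSetting (X : SemiGraphs.TemperedArithmeticGroup.{u₀} K) {D₀ : Type u₀} [Category.{v₀} D₀]
    {V : FrdIMonoidStub.{w}} (T : RealifiedDivisorMonoids (D₀ := D₀) V)
    (D : Type u) [Category.{v} D] (VD : FrdICatStub.{u, v, w} D) : Type (max u₀ v₀ u v w + 2) where
  /-- the tempered Frobenioid of §3 underlying the setting (its category is `tf.category`) -/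
  tf : TemperedFrobenioid T D VD
  /-- "whose monoid type is `ℤ`" -/
  monoidType_eq : tf.monoidType = MonoidType.Z
  /-- "whose divisor monoid `Φ` is perfect" ([FrdI] §0; tree `IsPerfect`) -/
  isPerfect : ∀ A : Dᵒᵖ, IsPerfect (tf.Φ.carrier A)
  /-- "`Div(s'), Div(s'')` have disjoint supports [cf. [FrdI], Proposition 4.1, (iii)]" (supports in
  the perf-factorial monoid `Φ(A)`, [FrdI] Def 2.4 (i)(d)); TODO-merge(abc-iut-L1-t3) -/
  DisjointSupports : ∀ {A : Dᵒᵖ}, tf.Φ.carrier A → tf.Φ.carrier A → Prop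
  /-- `O^×(A^birat)`, the units of the image of `A` in the birationalization `C^birat` ([FrdI]
  Prop 4.4); TODO-merge(abc-iut-L1-t3) -/
  biratUnits : tf.category → Type w
  /-- group structure on `O^×(A^birat)` -/
  [instBirat : ∀ A, CommGroup (biratUnits A)]
  /-- the natural action of `Aut_C(A)` on `O^×(A^birat)` (functoriality of `C → C^birat`) -/
  biratAut : ∀ A : tf.category, Aut A →* MulAut (biratUnits A)
  /-- "pre-steps of `C` map to isomorphisms in `C^birat` [cf. [FrdI], Proposition 4.4, (iv)]": the
  isomorphism `O^×(A^birat) ≅ O^×(B^birat)`, `f ↦ f|_B`, along a pre-step `s : A → B` -/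
  restrictAlong : ∀ {A B : tf.category} (s : A ⟶ B), PreFrobenioid.IsPreStep tf.toElem s →
    biratUnits A ≃* biratUnits B
  /-- "any base-equivalent pair of pre-steps `s', s'' : A → B` … determines, by inverting the image of
  `s''` in `C^birat`, an element '`s' · (s'')⁻¹`' `∈ O^×(A^birat)`" (p.86) -/
  fracOf : ∀ {A B : tf.category} (s' s'' : A ⟶ B), PreFrobenioid.IsPreStep tf.toElem s' →
    PreFrobenioid.IsPreStep tf.toElem s'' → PreFrobenioid.BaseEquivalent tf.toElem s' s'' → biratUnits A
  /-- Galois objects of `D` ([SemiAnbd] Def 3.1 (iv)); TODO-merge(abc-iut-L3-t2) -/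
  IsGaloisObj : D → Prop
  /-- "the natural surjective outer homomorphism `Π^tp_X ↠ Aut_D(A^bs)`" for Galois `A^bs` (Def 4.1
  (ii), p.87; [FrdII] Def 2.2 (i)) — one representative of the outer class -/
  galoisSurj : ∀ (A : D), IsGaloisObj A → (X.Pi →* Aut A)
  /-- its surjectivity -/
  galoisSurj_surjective : ∀ (A : D) (h : IsGaloisObj A), Function.Surjective (galoisSurj A h)
  /-- "`(N, H_⊙^{bs-fld})`-saturated [cf. [FrdII], Definition 2.2, (ii)] as an object of `C^{bs-fld}`"
  for a Frobenius-trivial object and a normal open `H^{bs-fld} ⊆ G_K` ((a) `μ_N`-saturated, (b)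
  Galois base, (c) `H ↠ H_A` induces isomorphisms on `H¹(-, μ_N(A))`, `H¹(-, ℤ/Nℤ)` and a
  surjection on `H²(-, μ_N(A))`); TODO-merge(abc-iut-L1-t4) -/
  IsNHSaturatedBsFld : Subgroup (Field.absoluteGaloisGroup K) → tf.category → ℕ+ → Prop
  /-- "`G, α', α''` arise from a base-Frobenius pair of `C` [cf. Theorem 3.7, (i); [FrdI], Proposition
  5.6]" ([FrdI] Def 2.7 (iii)); TODO-merge(abc-iut-L1-t2) -/
  ArisesFromBaseFrobeniusPair : ∀ {A B : tf.category}, Subgroup (Aut A) → (A ⟶ A) → (A ⟶ B) → Prop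
  /-- the object `A_⊙ ∈ Ob(C)` (p.86) -/
  Aodot : tf.category
  /-- "a Frobenius-trivial object `A_⊙`" ([FrdI] Def 1.2 (iv), tree `PreFrobenioid.IsFrobeniusTrivial`) -/
  isFrobeniusTrivial_Aodot : PreFrobenioid.IsFrobeniusTrivial tf.toElem Aodot
  /-- "`A_⊙^bs := Base(A_⊙) ∈ Ob(D)` is a Galois object" -/
  isGalois_Aodot : IsGaloisObj Aodot.base

namespace BiKummerSetting

attribute [instance] BiKummerSetting.instBirat

variable {X : SemiGraphs.TemperedArithmeticGroup.{u₀} K} {D₀ : Type u₀} [Category.{v₀} D₀] {V : FrdIMonoidStub.{w}}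
  {T : RealifiedDivisorMonoids (D₀ := D₀) V} {D : Type u} [Category.{v} D]
  {VD : FrdICatStub.{u, v, w} D} (S : BiKummerSetting X T D VD)

/-! ### The Frobenioid `C` and its [FrdI] Def 1.2 vocabulary (real, via `TemperedFrobenioidModel`) -/

/-- The Frobenioid `C` of the setting: the category of the tempered Frobenioid (Def 3.6 (ii)).
[cite: MochizukiEtTh2009, Def 4.1 p.86] -/
abbrev C : Type (max u w) := S.tf.category

/-- `Base : C → D`. [cite: MochizukiEtTh2009, Def 4.1 p.86] -/
noncomputable abbrev base : S.C ⥤ D := S.tf.baseFunctorOfCategory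

/-- The pre-Frobenioid structure `C → F_Φ`. [cite: MochizukiEtTh2009, Def 4.1 p.86] -/
noncomputable abbrev F : S.C ⥤ ElemFrobenioid S.tf.divisorMonoid := S.tf.toElem

/-- pre-steps of `C` ([FrdI] Def 1.2 (iii), tree). [cite: MochizukiEtTh2009, Def 4.1 p.86] -/
abbrev IsPreStep {A B : S.C} (φ : A ⟶ B) : Prop := PreFrobenioid.IsPreStep S.F φ

/-- linear morphisms ([FrdI] Def 1.2 (i), tree). [cite: MochizukiEtTh2009, Def 4.1 p.86] -/
abbrev IsLinear {A B : S.C} (φ : A ⟶ B) : Prop := PreFrobenioid.IsLinear S.F φ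

/-- pull-back morphisms ([FrdI] Def 1.2 (ii), tree). [cite: MochizukiEtTh2009, Def 4.1 p.87] -/
abbrev IsPullback {A B : S.C} (φ : A ⟶ B) : Prop := PreFrobenioid.IsPullbackMorphism S.F φ

/-- morphisms of Frobenius type ([FrdI] Def 1.2 (iii), tree). [cite: MochizukiEtTh2009, Def 4.1 p.87] -/
abbrev IsFrobeniusType {A B : S.C} (φ : A ⟶ B) : Prop := PreFrobenioid.IsFrobeniusType S.F φ

/-- isometries ([FrdI] Def 1.2 (i), tree). [cite: MochizukiEtTh2009, Prop 4.2 p.88] -/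
abbrev IsIsometry {A B : S.C} (φ : A ⟶ B) : Prop := PreFrobenioid.IsIsometry S.F φ

/-- base-identity endomorphisms ([FrdI] Def 1.2 (ii), tree). [cite: MochizukiEtTh2009, Def 4.1 p.87] -/
abbrev IsBaseIdentity {A : S.C} (φ : A ⟶ A) : Prop := PreFrobenioid.IsBaseIdentity S.F φ

/-- the Frobenius degree `deg_Fr` ([FrdI] Def 1.1, tree). [cite: MochizukiEtTh2009, Def 4.1 p.87] -/
abbrev degFr {A B : S.C} (φ : A ⟶ B) : ℕ+ := PreFrobenioid.degFr S.F φ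

/-- `O^×(A) ⊆ Aut_C(A)` ([FrdI] Def 1.2 (ii), tree). [cite: MochizukiEtTh2009, Def 4.1 p.87] -/
noncomputable abbrev units (A : S.C) : Subgroup (Aut A) := S.tf.units A

/-- Frobenius-trivial objects ([FrdI] Def 1.2 (iv), tree). [cite: MochizukiEtTh2009, Def 4.1 p.87] -/
abbrev IsFrobeniusTrivial (A : S.C) : Prop := PreFrobenioid.IsFrobeniusTrivial S.F A

/-- the zero divisor `Div(φ) ∈ Φ(Base A)` ([FrdI] Def 1.1 (iv), tree). [cite: MochizukiEtTh2009, Def 4.1 p.86] -/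
abbrev div {A B : S.C} (φ : A ⟶ B) : S.tf.Φ.carrier (op A.base) := ModelFrobenioid.div φ

/-- `μ_N(A) ⊆ O^×(A)` ([FrdII] Def 2.1 (i)). [cite: MochizukiEtTh2009, Def 4.1 p.87] -/
abbrev mu (A : S.C) (N : ℕ+) : Set (Aut A) := S.tf.mu A N

/-- `μ_N`-saturated objects ([FrdII] Def 2.1 (i)). [cite: MochizukiEtTh2009, Def 4.1 p.87] -/
abbrev IsMuSaturated (A : S.C) (N : ℕ+) : Prop := S.tf.IsMuSaturated A N

/-- `H_⊙ ⊆ Π^tp_X`: the normal open subgroup determined by the Galois object `A_⊙^bs` (p.86) — the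
kernel of `Π^tp_X ↠ Aut_D(A_⊙^bs)`. [cite: MochizukiEtTh2009, Def 4.1 p.86] -/
def Hodot : Subgroup X.Pi := (S.galoisSurj _ S.isGalois_Aodot).ker

/-- `H_⊙^{bs-fld} ⊆ G_K`: "the image of `H_⊙` in `G_K`" (p.86). [cite: MochizukiEtTh2009, Def 4.1 p.86] -/
def HodotBsFld : Subgroup (Field.absoluteGaloisGroup K) := S.Hodot.map X.aug.toMonoidHom

/-! ## Definition 4.1 (pp.86–87) -/

/-- **Definition 4.1 (i)** (pp.86–87): for `f ∈ O^×(A^birat)`, "a *fraction-pair* [or *right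
fraction-pair*] for `f`" is "any base-equivalent pair of pre-steps `s', s'' : A → B` such that
`s' · (s'')⁻¹ = f ∈ O^×(A^birat)`, and, moreover, `Div(s'), Div(s'')` have disjoint supports". `A` is
the *domain*, `B` the *codomain*; `Div(s')` the *zero divisor*, `Div(s'')` the *divisor of poles*.
ERRATUM E2-(B) ([IUTchI] Rmk 3.2.4 (iv)(B)): see `FractionPair.CondD`.
[cite: MochizukiEtTh2009, Def 4.1 p.86] -/
structure FractionPair {A : S.C} (f : S.biratUnits A) (B : S.C) where
  /-- the "numerator" pre-step `s'` -/
  num : A ⟶ B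
  /-- the "denominator" pre-step `s''` -/
  den : A ⟶ B
  /-- `s'` is a pre-step -/
  isPreStep_num : S.IsPreStep num
  /-- `s''` is a pre-step -/
  isPreStep_den : S.IsPreStep den
  /-- `s', s''` are base-equivalent: `Base(s') = Base(s'')` ([FrdI] Def 1.2 (ii)) -/
  base_eq : PreFrobenioid.BaseEquivalent S.F num den
  /-- `s' · (s'')⁻¹ = f` in `O^×(A^birat)` -/
  frac_eq : S.fracOf num den isPreStep_num isPreStep_den base_eq = f
  /-- `Div(s')`, `Div(s'')` have disjoint supports -/
  disjointSupports : S.DisjointSupports (S.div num) (S.div den)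

namespace FractionPair

variable {S} {A B : S.C} {f : S.biratUnits A} (P : S.FractionPair f B)

/-- The *zero divisor* `Div(s')` of the fraction-pair (p.87). [cite: MochizukiEtTh2009, Def 4.1 p.87] -/
def zeroDivisor : S.tf.Φ.carrier (op A.base) := S.div P.num

/-- The *divisor of poles* `Div(s'')` of the fraction-pair (p.87). [cite: MochizukiEtTh2009, Def 4.1 p.87] -/
def poleDivisor : S.tf.Φ.carrier (op A.base) := S.div P.den

/-- `f|_B ∈ O^×(B^birat)`, "the element determined by `(s', s'')` [cf. [FrdI], Proposition 4.4, (iv)]";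
`(s', s'')` is then "a *left fraction-pair* [for `f|_B`]" (p.87). [cite: MochizukiEtTh2009, Def 4.1 p.87] -/
def restrict : S.biratUnits B := S.restrictAlong P.num P.isPreStep_num f

/-- ERRATUM E2, approach (B) ([IUTchI] Rmk 3.2.4 (iv)(B), kurims p.76): condition (d) on
`f ∈ O^×(A^birat)` — "for every `N ∈ ℕ_{≥1}`, there exists a linear morphism `A' → A` in `C` such
that the pull-back of `f` to `A'` admits an `N`-th root" (pull-back of birational units along a
linear morphism rendered by the `Aut`-free transport datum `pull`). Recorded as a predicate; IUT
uses approach (A) instead. [cite: MochizukiEtTh2009, Def 4.1 p.86] -/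
def CondD (pull : ∀ {A' : S.C} (_ : A' ⟶ A), S.biratUnits A → S.biratUnits A') : Prop :=
  ∀ N : ℕ+, ∃ (A' : S.C) (φ : A' ⟶ A), S.IsLinear φ ∧ ∃ g : S.biratUnits A', g ^ (N : ℕ) = pull φ f

end FractionPair

/-- The homomorphism `Aut_C(A) → Aut_D(A^bs)` induced by `Base` (Def 4.1 (ii), p.87: "the natural
injection `Aut_C(A)/O^×(A) ↪ Aut_D(A^bs)`" is its factorisation). [cite: MochizukiEtTh2009, Def 4.1 p.87] -/
noncomputable def autBase (A : S.C) : Aut A →* Aut A.base := S.base.mapAut A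

/-- **Definition 4.1 (ii)** (p.87): "We shall say that `A` is *Galois* if `A^bs ∈ Ob(D)` is Galois."
[cite: MochizukiEtTh2009, Def 4.1 p.87] -/
def IsGalois (A : S.C) : Prop := S.IsGaloisObj A.base

/-- **Definition 4.1 (ii)** (p.87): `H_A^bs ⊆ Aut_D(A^bs)`, "the image of `H_⊙` via this surjection
[which is well-defined, since `H_⊙` is normal]". [cite: MochizukiEtTh2009, Def 4.1 p.87] -/
def HAbs (A : S.C) (hA : S.IsGalois A) : Subgroup (Aut A.base) :=
  S.Hodot.map (S.galoisSurj _ hA)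

/-- **Definition 4.1 (ii)** (p.87): `H_A ⊆ Aut_C(A)/O^×(A)`, "the inverse image of `H_A^bs` via the
natural injection `Aut_C(A)/O^×(A) ↪ Aut_D(A^bs)`" — here as the corresponding subgroup of
`Aut_C(A)` containing `O^×(A)` (its preimage under `autBase`). [cite: MochizukiEtTh2009, Def 4.1 p.87] -/
def HA (A : S.C) (hA : S.IsGalois A) : Subgroup (Aut A) := (S.HAbs A hA).comap (S.autBase A)

/-- **Definition 4.1 (ii)** (p.87): "If the natural injection `H_A → H_A^bs` is a bijection, then we
shall say that `A` is *`H_⊙`-ample*" — i.e. every element of `H_A^bs` lifts to `Aut_C(A)`.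
[cite: MochizukiEtTh2009, Def 4.1 p.87] -/
structure IsAmple (A : S.C) : Prop where
  /-- `A` is Galois -/
  isGalois : S.IsGalois A
  /-- `H_A → H_A^bs` is surjective -/
  surj : S.HAbs A isGalois ≤ (S.autBase A).range

/-- `f ∈ O^×(A^birat)` "is an element fixed by the natural action of `H_A`" (Def 4.1 (iii), p.87).
[cite: MochizukiEtTh2009, Def 4.1 p.87] -/
def IsFixedByHA (A : S.C) (hA : S.IsGalois A) (f : S.biratUnits A) : Prop :=
  ∀ σ ∈ S.HA A hA, S.biratAut A σ f = f

/-- **Definition 4.1 (iii)** (p.87): for `H_⊙`-ample `A`, `f ∈ O^×(A^birat)` fixed by `H_A`, and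
`N ∈ ℕ_{≥1}`, "`A` is `(N, H_⊙, f)`-*saturated* if …: (a) there exist pre-steps `A' → A`, `A' → A''`
in `C`, where `A''` is Frobenius-trivial [hence determines an object of … `C^{bs-fld}`], such that
`A''` is `(N, H_⊙^{bs-fld})`-saturated [cf. [FrdII], Definition 2.2, (ii)] as an object of `C^{bs-fld}`;
(b) there exists a `g ∈ O^×(A^birat)` such that `g^N = f`." [cite: MochizukiEtTh2009, Def 4.1 p.87] -/
structure IsSaturated (A : S.C) (N : ℕ+) (f : S.biratUnits A) : Prop where
  /-- `A` is `H_⊙`-ample -/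
  isAmple : S.IsAmple A
  /-- `f` is fixed by `H_A` -/
  fixed : S.IsFixedByHA A isAmple.isGalois f
  /-- (a) the linked Frobenius-trivial object `A''`, `(N, H_⊙^{bs-fld})`-saturated in `C^{bs-fld}` -/
  cond_a : ∃ (A' A'' : S.C) (s₁ : A' ⟶ A) (s₂ : A' ⟶ A''), S.IsPreStep s₁ ∧ S.IsPreStep s₂ ∧
    S.IsFrobeniusTrivial A'' ∧ S.IsNHSaturatedBsFld S.HodotBsFld A'' N
  /-- (b) `f` has an `N`-th root in `O^×(A^birat)` -/
  cond_b : ∃ g : S.biratUnits A, g ^ (N : ℕ) = f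

/-- The automorphisms of `A` over `α : A → B`, `Aut_{C_B}(α) ⊆ Aut_C(A)` (Def 4.1 (iv), p.87).
[cite: MochizukiEtTh2009, Def 4.1 p.87] -/
def autOver {A B : S.C} (α : A ⟶ B) : Subgroup (Aut A) where
  carrier := {σ | σ.hom ≫ α = α}
  one_mem' := by change (Iso.refl A).hom ≫ α = α; simp
  mul_mem' {σ τ} hσ hτ := by
    change (τ.trans σ).hom ≫ α = α
    rw [Iso.trans_hom, Category.assoc, hσ, hτ]
  inv_mem' {σ} hσ := by
    change σ.symm.hom ≫ α = α
    rw [Iso.symm_hom, ← hσ, Iso.inv_hom_id_assoc, hσ]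

/-- `Gal(A^bs/B^bs) ⊆ Aut_D(A^bs)`, the automorphisms of `A^bs` over `α^bs` (Def 4.1 (iv)(b), p.87).
[cite: MochizukiEtTh2009, Def 4.1 p.87] -/
def galOver {A B : S.C} (α : A ⟶ B) : Subgroup (Aut A.base) where
  carrier := {σ | σ.hom ≫ ModelFrobenioid.baseMap α = ModelFrobenioid.baseMap α}
  one_mem' := by
    change (Iso.refl _).hom ≫ ModelFrobenioid.baseMap α = ModelFrobenioid.baseMap α; simp
  mul_mem' {σ τ} hσ hτ := by
    change (τ.trans σ).hom ≫ ModelFrobenioid.baseMap α = ModelFrobenioid.baseMap α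
    rw [Iso.trans_hom, Category.assoc, hσ, hτ]
  inv_mem' {σ} hσ := by
    change σ.symm.hom ≫ ModelFrobenioid.baseMap α = ModelFrobenioid.baseMap α
    rw [Iso.symm_hom, ← hσ, Iso.inv_hom_id_assoc, hσ]

/-- **Definition 4.1 (iv)** (p.87): "`α : A → B` … is of *base-Frobenius type* if there exist a
subgroup `G ⊆ Aut_{C_B}(α) ⊆ Aut_C(A)` and a factorization `α = α' ∘ α''` such that: (a) `A` is
Frobenius-trivial, Galois, and `μ_N`-saturated …, where `N := deg_Fr(α)`; (b) `G` maps isomorphically to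
`Gal(A^bs/B^bs) ⊆ Aut_D(A^bs)`; (c) `α''` is a base-identity endomorphism of Frobenius type; (d) `α'`
is a pull-back morphism; (e) `G, α', α''` arise from a base-Frobenius pair of `C`". The witnessing
data `(G, α', α'')` "of base-Frobenius type" is this structure (composition diagrammatic:
`α = α'' ≫ α'`). [cite: MochizukiEtTh2009, Def 4.1 p.87] -/
structure BaseFrobeniusTypeData {A B : S.C} (α : A ⟶ B) where
  /-- the subgroup `G ⊆ Aut_{C_B}(α)` -/
  G : Subgroup (Aut A)
  /-- `G ⊆ Aut_{C_B}(α)` -/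
  G_le : G ≤ S.autOver α
  /-- `α'' : A → A` -/
  α₂ : A ⟶ A
  /-- `α' : A → B` -/
  α₁ : A ⟶ B
  /-- `α = α' ∘ α''` -/
  fac : α₂ ≫ α₁ = α
  /-- (a) `A` Frobenius-trivial -/
  isFrobeniusTrivial : S.IsFrobeniusTrivial A
  /-- (a) `A` Galois -/
  isGalois : S.IsGalois A
  /-- (a) `A` is `μ_N`-saturated, `N = deg_Fr(α)` -/
  isMuSaturated : S.IsMuSaturated A (S.degFr α)
  /-- (b) `G → Gal(A^bs/B^bs)` is a bijection onto -/
  mapsIsomorphically : Set.BijOn (S.autBase A) G (S.galOver α)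
  /-- (c) `α''` is a base-identity endomorphism of Frobenius type -/
  cond_c : S.IsBaseIdentity α₂ ∧ S.IsFrobeniusType α₂
  /-- (d) `α'` is a pull-back morphism -/
  cond_d : S.IsPullback α₁
  /-- (e) `G, α', α''` arise from a base-Frobenius pair of `C` -/
  cond_e : S.ArisesFromBaseFrobeniusPair G α₂ α₁

/-- **Definition 4.1 (iv)** (p.87): `α` is of *base-Frobenius type* if such data exist.
[cite: MochizukiEtTh2009, Def 4.1 p.87] -/
def IsOfBaseFrobeniusType {A B : S.C} (α : A ⟶ B) : Prop := Nonempty (S.BaseFrobeniusTypeData α)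

/-- **Remark 4.1.1** (p.88): "if `α : A → B` is of base-Frobenius type, then … `A → B` is a categorical
quotient [cf. [FrdI], §0] of `A` by the subgroup `G · μ_N(A) ⊆ Aut_C(A)` in the full subcategory of `C`
determined by the Frobenius-trivial objects". Named `Prop`: the categorical-quotient property of [FrdI]
§0 p.18 (cf. the tree's `IsCategoricalQuotient`) with the TEST OBJECTS RESTRICTED to the Frobenius-trivial
ones, exactly as printed (`G · μ_N(A)` as the subgroup generated); only the universal property is typed
(that `B` itself is Frobenius-trivial is part of print's "in the full subcategory" and is not restated).
[cite: MochizukiEtTh2009, Rmk 4.1.1 p.88] -/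
def Remark411 : Prop :=
  ∀ {A B : S.C} (α : A ⟶ B) (d : S.BaseFrobeniusTypeData α),
    (∀ γ ∈ d.G ⊔ Subgroup.closure (S.mu A (S.degFr α)), γ.hom ≫ α = α) ∧
      ∀ ⦃X : S.C⦄, S.IsFrobeniusTrivial X → ∀ ψ : A ⟶ X,
        (∀ γ ∈ d.G ⊔ Subgroup.closure (S.mu A (S.degFr α)), γ.hom ≫ ψ = ψ) →
          ∃! ψ' : B ⟶ X, α ≫ ψ' = ψ

end BiKummerSetting

end Literature.AnabelianGeometry.EtaleTheta
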